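import Summits.Schanuel.Schanuel.Theorems.RootDecomp1KHyper45

/-!
# RootDecomp1KHyper — lens 6, generation 15 ADDENDUM 4 «UNIFORM n-PARAMETRIC ANCHORED THEOREM» (MeasuredAnchors.lean d7ef80c6…, 1059 l) — continuation (RootDecomp1KHyper46): §D (section `Uniform`): `exists_coord_not_mem_span`, THE UNIFORM n-PARAMETRIC ANCHORED THEOREM `sb_of_measuredRatAnchors` (all `k`, no named fact) and its `k = 2` instance `sb_three_of_measuredRatAnchor'`

(lens-6 g15 ADDENDUM 4 `MeasuredAnchors.lean`, sha256 d7ef80c6…6d97, own farm rc 0 · 0 sorry · axioms std; critic VERDICT STATUS L1634 (K-R18 MET; PORT GO (e)),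
CENSUS-REQUEST L1629; port by census-1 gen 15 in five parts RootDecomp1KHyper42–46; statements and proofs verbatim, one-line docstrings added,
generic one-liners / twins of landed lemmas made `private` with per-part private copies; `--supports stmt-Schanuel-33363`, no census credit.
Nothing here proves Schanuel; rung 0.)
-/

open Complex IntermediateField Polynomial

namespace Summit.Schanuel.Schanuel.Theorems.RootDecomp1KHyper

namespace HyperCell

/-! ## §D  The uniform n-parametric anchored theorem -/

section Uniform

/-- Integer polynomials in `θ` lie in `ℚ[θ]`. -/
private theorem aeval_int_mem_adjoin' {n : ℕ} (θ : Fin n → ℂ) (q : MvPolynomial (Fin n) ℤ) :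
    MvPolynomial.aeval θ q ∈ Algebra.adjoin ℚ (Set.range θ) := by
  apply MvPolynomial.induction_on q
  · intro a
    rw [MvPolynomial.aeval_C, algebraMap_int_eq, Int.coe_castRingHom]
    exact intCast_mem (Algebra.adjoin ℚ (Set.range θ)) a
  · intro p p' hp hp'
    rw [map_add]; exact add_mem hp hp'
  · intro p i hp
    rw [map_mul, MvPolynomial.aeval_X]; exact mul_mem hp (Algebra.subset_adjoin ⟨i, rfl⟩)

/-- Transcendence descent: if `(c y, θ)` is algebraically independent with `c ∈ ℚ[θ]`, so is
`(y, θ)`. -/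
private theorem algebraicIndependent_option_of_mul' {n : ℕ} {θ : Fin n → ℂ} {y c : ℂ}
    (hc : c ∈ Algebra.adjoin ℚ (Set.range θ)) (hθ : AlgebraicIndependent ℚ θ)
    (h : AlgebraicIndependent ℚ (fun o : Option (Fin n) => o.elim (c * y) θ)) :
    AlgebraicIndependent ℚ (fun o : Option (Fin n) => o.elim y θ) := by
  rw [hθ.option_iff_transcendental] at h ⊢
  intro hy
  apply h
  have hc' : IsAlgebraic (Algebra.adjoin ℚ (Set.range θ)) c := by
    simpa using isAlgebraic_algebraMap (R := Algebra.adjoin ℚ (Set.range θ)) (A := ℂ)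
      (⟨c, hc⟩ : Algebra.adjoin ℚ (Set.range θ))
  exact hc'.mul hy

/-- A ℚ-free `(k+1)`-tuple has a coordinate outside the ℚ-span of any `k` vectors. -/
theorem exists_coord_not_mem_span {k : ℕ} {z : Fin (k + 1) → ℂ} (hz : LinearIndependent ℚ z)
    (v : Fin k → ℂ) : ∃ j, z j ∉ Submodule.span ℚ (Set.range v) := by
  by_contra hcon
  push Not at hcon
  have hle : Submodule.span ℚ (Set.range z) ≤ Submodule.span ℚ (Set.range v) := by
    rw [Submodule.span_le]; rintro _ ⟨j, rfl⟩; exact hcon j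
  haveI : FiniteDimensional ℚ (Submodule.span ℚ (Set.range v)) :=
    FiniteDimensional.span_of_finite ℚ (Set.finite_range v)
  have h1 := Submodule.finrank_mono hle
  rw [finrank_span_eq_card hz, Fintype.card_fin] at h1
  have h2 : Module.finrank ℚ (Submodule.span ℚ (Set.range v)) ≤ Fintype.card (Fin k) :=
    finrank_range_le_card (R := ℚ) v
  rw [Fintype.card_fin] at h2
  omega

/-- **THE UNIFORM n-PARAMETRIC ANCHORED THEOREM (K-R18).**  For every `k`: let `z : Fin (k+1) → ℂ`
be ℚ-linearly independent and `HyperLinLiouville`; let `θ : Fin k → ℂ` be ANY `k`-tuple with a weak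
simultaneous transcendence measure (`MvWeakMeasure θ`) lying in the Schanuel field `ℚ(z, e^z, i)`;
and let `span_ℤ(z)` contain `k` anchors `v_l = W_l(θ)/q(θ)` that are ℚ(θ)-RATIONAL functions of `θ`
(`q(θ) ≠ 0`) with `W_0, …, W_{k-1} ∈ ℤ[x]` polynomially independent
(`Σ U_l W_l ≠ 0` for integer `U ≠ 0`).  Then Schanuel's bound holds for `z`:
`trdeg ℚ(z, e^z) ≥ k + 1`.  ONE proof for all `k` (Siegel's lemma + the k-ary weak Lemma L + the
hyper-polynomial engine of §B + transcendence descent); NO named fact in the statement.  The binary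
theorems of Hyper28/29 and of g15 §8–§9 (`k = 2`) are its first instance. -/
theorem sb_of_measuredRatAnchors {k : ℕ} {z : Fin (k + 1) → ℂ} (hz : LinearIndependent ℚ z)
    (hH : HyperLinLiouville z) {θ : Fin k → ℂ} (hθ : MvWeakMeasure θ)
    (hθz : ∀ i, θ i ∈ adjoin ℚ (SFset z ∪ {I}))
    (W : Fin k → MvPolynomial (Fin k) ℤ) (q : MvPolynomial (Fin k) ℤ)
    (hq : MvPolynomial.aeval θ q ≠ 0)
    (hW : ∀ U : Fin k → ℤ, U ≠ 0 → ∑ l, MvPolynomial.C (U l) * W l ≠ 0)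
    {v : Fin k → ℂ} (hv : ∀ l, MvPolynomial.aeval θ q * v l = MvPolynomial.aeval θ (W l))
    (hvz : ∀ l, v l ∈ Submodule.span ℤ (Set.range z)) : SB (k + 1) z := by
  classical
  have hcoord : ∀ l, ∃ c : Fin (k + 1) → ℤ, ∑ i, (c i : ℂ) * z i = v l := by
    intro l
    obtain ⟨c, hc⟩ := (Submodule.mem_span_range_iff_exists_fun ℤ).mp (hvz l)
    refine ⟨c, ?_⟩
    simpa only [zsmul_eq_mul] using hc
  choose a ha using hcoord
  have hva : (fun l => ∑ i, (a l i : ℂ) * z i) = v := funext ha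
  obtain ⟨j, hj⟩ := exists_coord_not_mem_span hz v
  rw [← hva] at hj
  have hv' : ∀ l, MvPolynomial.aeval θ q * (∑ i, (a l i : ℂ) * z i) =
      MvPolynomial.aeval θ (W l) := fun l => by rw [ha l]; exact hv l
  have hWd : ∀ l, (W l).totalDegree ≤ Finset.univ.sup fun l => (W l).totalDegree := fun l =>
    Finset.le_sup (f := fun l => (W l).totalDegree) (Finset.mem_univ l)
  have hy := hyperPolyApprox_of_anchors hz hH hθ W q hq hW a hv' hj hWd
  have hai := algebraicIndependent_option_of_mvWeakMeasure_hyperPoly hθ hy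
  have hai' := algebraicIndependent_option_of_mul' (aeval_int_mem_adjoin' θ q)
    (algebraicIndependent_of_mvWeakMeasure hθ) hai
  refine sb_of_algebraicIndependent hai' (by simp) fun o => ?_
  cases o with
  | none => exact mem_adjoin_SFset_I' (Or.inl ⟨j, rfl⟩)
  | some i => exact hθz i

-- PORT (census-1 gen 15): the `k = 2` instance restates the landed `…HyperCell.LatCell.sb_three_of_measuredRatAnchor`
-- (RootDecomp1KHyper41) BY DESIGN (dedup.landed bounce p811890) — kept as a `private` demonstration corollary.
/-- **Instance `k = 2`** (the format of g15 §9 / Hyper28–29): binary polynomial independence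
`∀ U V, (U ≠ 0 ∨ V ≠ 0) → U W₁ + V W₂ ≠ 0` is the `k = 2` case of the k-ary hypothesis. -/
private theorem sb_three_of_measuredRatAnchor' {z : Fin 3 → ℂ} (hz : LinearIndependent ℚ z)
    (hH : HyperLinLiouville z) {θ : Fin 2 → ℂ} (hθ : MvWeakMeasure θ)
    (hθz : ∀ i, θ i ∈ adjoin ℚ (SFset z ∪ {I})) (W₁ W₂ q : MvPolynomial (Fin 2) ℤ)
    (hq : MvPolynomial.aeval θ q ≠ 0)
    (hW : ∀ U V : ℤ, (U ≠ 0 ∨ V ≠ 0) → MvPolynomial.C U * W₁ + MvPolynomial.C V * W₂ ≠ 0)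
    {v₁ v₂ : ℂ} (hv₁ : MvPolynomial.aeval θ q * v₁ = MvPolynomial.aeval θ W₁)
    (hv₂ : MvPolynomial.aeval θ q * v₂ = MvPolynomial.aeval θ W₂)
    (h₁ : v₁ ∈ Submodule.span ℤ (Set.range z)) (h₂ : v₂ ∈ Submodule.span ℤ (Set.range z)) :
    SB 3 z := by
  refine sb_of_measuredRatAnchors (k := 2) hz hH hθ hθz ![W₁, W₂] q hq ?_ (v := ![v₁, v₂]) ?_ ?_
  · intro U hU
    have hU' : U 0 ≠ 0 ∨ U 1 ≠ 0 := by
      by_contra hc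
      push Not at hc
      apply hU; funext i
      match i with
      | 0 => exact hc.1
      | 1 => exact hc.2
    simpa [Fin.sum_univ_two] using hW (U 0) (U 1) hU'
  · intro l
    match l with
    | 0 => simpa using hv₁
    | 1 => simpa using hv₂
  · intro l
    match l with
    | 0 => simpa using h₁
    | 1 => simpa using h₂

end Uniform

end HyperCell

end Summit.Schanuel.Schanuel.Theorems.RootDecomp1KHyper
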